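import Mathlib

/-!
# The fat-node potential: at most `2|U₀|/D + 1` fat OR-nodes on a path (per-path Corneil–Goldberg bound, `NoHiddenOrder`)

Route `PneNP/SymmetryBudget`, `NoHiddenOrder` (stmt-PneNP-14781); memo `PER-PATH.md` §10, Theorem B, step (3) — the
counting half of the per-path bound, kept free of graphs. A FAT CHAIN of length `N` with threshold `D` is what the
consecutive fat OR-nodes of one root–leaf path of the Corneil–Goldberg tree give (Theorem B (1)–(2), whose graph-theoretic
input is `SymmetryBudgetNoHiddenOrderPerPathSwitchingClosure.lean`): vertex sets `U 0 ⊇ U 1 ⊇ …`, colourings `ρ i` whose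
cells inside `U i` all have more than `D` elements (fat), nested (on `U (i+1)` the colouring `ρ (i+1)` refines `ρ i`), and
PROGRESS between consecutive nodes — some cell of `ρ i` meets two cells of `ρ (i+1)` (a split) or keeps at most half of its
elements in `U (i+1)` (heavy loss; death included). Then `PerPath.fatChain_length_le`: `(N - 1) · D ≤ 2 · |U 0|` — the
potential `D · #cells + 2 · |removed|` grows by at least `D` per step (`potential_step`) and never exceeds `2|U 0|` (fat cells
give `D · #cells ≤ |U i|`, `mul_card_image_le_card`). With `D = n/q` this is `θ_q ≤ 2q + 1` OR-nodes of branching degree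
`> n/q` on one path, whence `Σ_OR log₂ d = O(n)` per path. Pure finite combinatorics; Mathlib only; no definitions.
-/

-- `Summit.PneNP.PneNP.…` duplicates `PneNP` BY DESIGN (single-problem summit, D-0017 layout).
set_option linter.dupNamespace false

namespace Summit.PneNP.PneNP.Theorems

namespace PerPath

open Finset

variable {α : Type*} [DecidableEq α]

omit [DecidableEq α] in
/-- Fat cells: if every fibre of `ρ` through a point of `U` has more than `D` elements in `U` then `D · #cells ≤ |U|`. -/
theorem mul_card_image_le_card (U : Finset α) (ρ : α → ℕ) (D : ℕ)
    (hfat : ∀ x ∈ U, D < (U.filter fun w => ρ w = ρ x).card) : D * (U.image ρ).card ≤ U.card := by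
  rw [card_eq_sum_card_image ρ U, mul_comm, ← smul_eq_mul, ← sum_const]
  refine sum_le_sum fun c hc => ?_
  obtain ⟨x, hx, rfl⟩ := mem_image.1 hc
  exact (hfat x hx).le

/-- Dead cells: the cells of `ρ` in `U` whose colour does not occur on `U' ⊆ U` are disjoint subsets of `U \ U'`, so their
sizes sum to at most `|U| - |U'|`. -/
theorem sum_card_dead_le {U U' : Finset α} (hU : U' ⊆ U) (ρ : α → ℕ) :
    ∑ c ∈ (U.image ρ).filter (fun c => c ∉ U'.image ρ), (U.filter fun w => ρ w = c).card ≤ U.card - U'.card := by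
  set Z := (U.image ρ).filter (fun c => c ∉ U'.image ρ) with hZ
  have hsub : U.filter (fun w => ρ w ∈ Z) ⊆ U \ U' := by
    intro w hw
    rw [mem_filter] at hw
    rw [mem_sdiff]
    exact ⟨hw.1, fun hwU' => (mem_filter.1 hw.2).2 (mem_image_of_mem ρ hwU')⟩
  have hcard : (U.filter fun w => ρ w ∈ Z).card = ∑ c ∈ Z, (U.filter fun w => ρ w = c).card := by
    rw [card_eq_sum_card_fiberwise (s := U.filter fun w => ρ w ∈ Z) (t := Z) (f := ρ) fun w hw =>
      mem_coe.2 (mem_filter.1 (mem_coe.1 hw)).2]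
    refine sum_congr rfl fun c hc => ?_
    rw [filter_filter]
    congr 1
    exact filter_congr fun w _ => ⟨fun h => h.2, fun h => ⟨h ▸ hc, h⟩⟩
  rw [← hcard, ← card_sdiff_of_subset hU]
  exact card_le_card hsub

/-- **The potential step.** For one step `U' ⊆ U` of a fat chain (cells of `ρ` in `U` larger than `D`; `ρ'` refining `ρ` on
`U'`; a split or a heavy loss), `D · #cells(ρ, U) + D ≤ D · #cells(ρ', U') + 2 (|U| - |U'|)`. -/
theorem potential_step {U U' : Finset α} (hU : U' ⊆ U) {ρ ρ' : α → ℕ} {D : ℕ}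
    (hnest : ∀ x ∈ U', ∀ y ∈ U', ρ' x = ρ' y → ρ x = ρ y)
    (hfat : ∀ x ∈ U, D < (U.filter fun w => ρ w = ρ x).card)
    (hprog : ∃ x ∈ U, (∃ u ∈ U', ∃ v ∈ U', ρ u = ρ x ∧ ρ v = ρ x ∧ ρ' u ≠ ρ' v) ∨
      (U.filter fun w => ρ w = ρ x).card ≤ 2 * ((U.filter fun w => ρ w = ρ x).filter fun w => w ∉ U').card) :
    D * (U.image ρ).card + D ≤ D * (U'.image ρ').card + 2 * (U.card - U'.card) := by
  classical
  -- surviving and dead colours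
  set C := U.image ρ with hC
  set S := C.filter (fun c => c ∈ U'.image ρ) with hS
  set Z := C.filter (fun c => c ∉ U'.image ρ) with hZ
  have hCSZ : C.card = S.card + Z.card := (card_filter_add_card_filter_not (s := C) (fun c => c ∈ U'.image ρ)).symm
  have hUU : U'.card ≤ U.card := card_le_card hU
  -- `ρ` factors through `ρ'` on `U'`
  obtain ⟨f, hf⟩ : ∃ f : ℕ → ℕ, ∀ x ∈ U', ρ x = f (ρ' x) := by
    refine ⟨fun c' => if h : ∃ x ∈ U', ρ' x = c' then ρ h.choose else 0, fun x hx => ?_⟩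
    have h : ∃ y ∈ U', ρ' y = ρ' x := ⟨x, hx, rfl⟩
    show ρ x = (if h : ∃ y ∈ U', ρ' y = ρ' x then ρ h.choose else 0)
    rw [dif_pos h]
    exact (hnest _ h.choose_spec.1 _ hx h.choose_spec.2).symm
  -- surviving colours are images of `ρ'`-colours
  have hS_eq : S = (U'.image ρ').image f := by
    ext c
    simp only [hS, hC, mem_filter, mem_image]
    constructor
    · rintro ⟨-, x, hx, rfl⟩
      exact ⟨ρ' x, ⟨x, hx, rfl⟩, (hf x hx).symm⟩
    · rintro ⟨c', ⟨x, hx, rfl⟩, rfl⟩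
      exact ⟨⟨x, hU hx, hf x hx⟩, x, hx, hf x hx⟩
  have hS_le : S.card ≤ (U'.image ρ').card := by rw [hS_eq]; exact card_image_le
  -- dead cells lie in `U \ U'`
  have hdead : D * Z.card + Z.card ≤ U.card - U'.card := by
    calc D * Z.card + Z.card = ∑ c ∈ Z, (D + 1) := by rw [sum_const, smul_eq_mul]; ring
      _ ≤ ∑ c ∈ Z, (U.filter fun w => ρ w = c).card := sum_le_sum fun c hc => by
          obtain ⟨x, hx, rfl⟩ := mem_image.1 (mem_filter.1 hc).1
          exact hfat x hx
      _ ≤ U.card - U'.card := sum_card_dead_le hU ρ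
  have hDS : D * S.card ≤ D * (U'.image ρ').card := Nat.mul_le_mul_left D hS_le
  obtain ⟨x, hx, hsplit | hheavy⟩ := hprog
  · -- a split: `f` is not injective on the `ρ'`-colours of `U'`, so one more cell survives the count
    obtain ⟨u, hu, v, hv, hux, hvx, huv⟩ := hsplit
    have hS_lt : S.card < (U'.image ρ').card := by
      refine lt_of_le_of_ne hS_le fun heq => huv ?_
      rw [hS_eq] at heq
      have hinj := card_image_iff.1 heq
      exact hinj (mem_coe.2 (mem_image_of_mem ρ' hu)) (mem_coe.2 (mem_image_of_mem ρ' hv))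
        (by rw [← hf u hu, ← hf v hv, hux, hvx])
    have hDS' : D * S.card + D ≤ D * (U'.image ρ').card := by
      have := Nat.mul_le_mul_left D hS_lt
      rw [Nat.mul_succ] at this
      exact this
    calc D * C.card + D = (D * S.card + D) + D * Z.card := by rw [hCSZ]; ring
      _ ≤ D * (U'.image ρ').card + (U.card - U'.card) := add_le_add hDS' (le_trans (Nat.le_add_right _ _) hdead)
      _ ≤ D * (U'.image ρ').card + 2 * (U.card - U'.card) := by omega
  · -- a heavy loss: the cell of `x` lost at least half of its `> D` elements
    have hloss : ((U.filter fun w => ρ w = ρ x).filter fun w => w ∉ U').card ≤ U.card - U'.card := by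
      rw [← card_sdiff_of_subset hU]
      exact card_le_card fun w hw => by
        simp only [mem_filter, mem_sdiff] at hw ⊢
        exact ⟨hw.1.1, hw.2⟩
    have hfx := hfat x hx
    have hD : D + 1 ≤ 2 * (U.card - U'.card) := by omega
    by_cases hZ0 : Z.card = 0
    · calc D * C.card + D = D * S.card + D := by rw [hCSZ, hZ0, add_zero]
        _ ≤ D * (U'.image ρ').card + 2 * (U.card - U'.card) := by omega
    · have hZ1 : D ≤ D * Z.card := Nat.le_mul_of_pos_right D (Nat.pos_of_ne_zero hZ0)
      calc D * C.card + D = D * S.card + (D * Z.card + D) := by rw [hCSZ]; ring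
        _ ≤ D * (U'.image ρ').card + 2 * (U.card - U'.card) := by omega

/-- **Fat chains are short** (PER-PATH.md Theorem B (3)): along a fat chain of length `N` with threshold `D` — nested
vertex sets, colourings with all cells `> D`, refinement, and a split or a heavy loss at every step — one has
`(N - 1) · D ≤ 2 · |U 0|`. -/
theorem fatChain_length_le (U : ℕ → Finset α) (ρ : ℕ → α → ℕ) (N D : ℕ)
    (hanti : ∀ i, i + 1 < N → U (i + 1) ⊆ U i)
    (hnest : ∀ i, i + 1 < N → ∀ x ∈ U (i + 1), ∀ y ∈ U (i + 1), ρ (i + 1) x = ρ (i + 1) y → ρ i x = ρ i y)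
    (hfat : ∀ i, i < N → ∀ x ∈ U i, D < ((U i).filter fun w => ρ i w = ρ i x).card)
    (hprog : ∀ i, i + 1 < N → ∃ x ∈ U i,
      (∃ u ∈ U (i + 1), ∃ v ∈ U (i + 1), ρ i u = ρ i x ∧ ρ i v = ρ i x ∧ ρ (i + 1) u ≠ ρ (i + 1) v) ∨
      ((U i).filter fun w => ρ i w = ρ i x).card ≤
        2 * (((U i).filter fun w => ρ i w = ρ i x).filter fun w => w ∉ U (i + 1)).card) :
    (N - 1) * D ≤ 2 * (U 0).card := by
  rcases Nat.eq_zero_or_pos N with rfl | hN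
  · simp
  -- the potential `Λ i = D · #cells_i + 2 (|U 0| - |U i|)` gains `D` per step and is at most `2 |U 0|`
  have hcardU : ∀ i, i < N → (U i).card ≤ (U 0).card := by
    intro i
    induction i with
    | zero => exact fun _ => le_rfl
    | succ i ih => exact fun hi => (card_le_card (hanti i hi)).trans (ih (by omega))
  have hΛ : ∀ i, i < N → i * D + 2 * (U i).card ≤ D * ((U i).image (ρ i)).card + 2 * (U 0).card := by
    intro i
    induction i with
    | zero => intro _; simp
    | succ i ih =>
      intro hi
      have hstep := potential_step (hanti i hi) (hnest i hi) (hfat i (by omega)) (hprog i hi)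
      have hUU := card_le_card (hanti i hi)
      have := ih (by omega)
      rw [Nat.succ_mul]
      omega
  have hlast := hΛ (N - 1) (by omega)
  have hcells := mul_card_image_le_card (U (N - 1)) (ρ (N - 1)) D (hfat (N - 1) (by omega))
  have := hcardU (N - 1) (by omega)
  omega

end PerPath

end Summit.PneNP.PneNP.Theorems
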